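import Mathlib
import Literature.Computability.Complexity.RangeAvoidance
import Literature.Computability.Complexity.SignDegreeXor
import Summits.PneNP.PneNP.Theorems.PstarPDT
import Summits.PneNP.PneNP.Theorems.PstarSALevel
import Summits.PneNP.PneNP.Theorems.PstarTyped
import Summits.PneNP.PneNP.Theorems.PstarGapLemma
import Summits.PneNP.PneNP.Theorems.PstarGapPeeling
import Summits.PneNP.PneNP.Theorems.PstarCentreFree
import Summits.PneNP.PneNP.Theorems.PstarChordRepair
import Summits.PneNP.PneNP.Theorems.PstarGapOne
import Summits.PneNP.PneNP.Theorems.PstarGapOneAll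
import Summits.PneNP.PneNP.Theorems.PstarGConstraint
import Summits.PneNP.PneNP.Theorems.PstarGSatSteps
import Summits.PneNP.PneNP.Theorems.PstarGSatStructure
import Summits.PneNP.PneNP.Theorems.PstarGSatNoChord
import Summits.PneNP.PneNP.Theorems.PstarGSatC4
import Summits.PneNP.PneNP.Theorems.PstarGSatChords

/-!
# The single-query rung: `GSat`, `GapOneAll` and `PstarGapOne` by name (ROUND-24 items T24.17′ / T24.17 / T24.12)

FRONTIER range-avoidance ladder, rung F-N3, ROUND 24 (cell `pnp-ideate`; restricted-model proof complexity — nothing here bears on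
`P` versus `NP`).  Assembly of the reader-graph induction (memo ROUND-24-PRESEED §13 R10(p); referee AUDIT-r10p-gsat-g43) from the
step files `PstarGSatSteps` ((a),(b),P7), `PstarGSatStructure` ((c)), `PstarGSatNoChord` ((d)), `PstarGSatChords` ((e)).

* `gSat : PstarGapOneAll.GSat` — strong induction on `J`; base `J = ∅` from the non-constancy witness; step by contradiction.
* `gapOneAll : PstarGapOneAll.GapOneAll` — `G = ∅`.
* `pstarGapOne : PstarGapOne.PstarGapOne` — the first rung of the crux with `K = 0` (`pstarGapOne_of_gapOneAll`).
-/

set_option linter.dupNamespace false -- `Summit.PneNP.PneNP.…`: summit = sub-problem name (D-0017 single-conjunct layout)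

open Finset Literature.Computability.Complexity
open scoped symmDiff
open Summit.PneNP.PneNP.Theorems.PstarPDT (parity)
open Summit.PneNP.PneNP.Theorems.PstarTyped (Typed)
open Summit.PneNP.PneNP.Theorems.PstarSALevel (varSet bdry BoundaryExpanding SimpleOverlap)
open Summit.PneNP.PneNP.Theorems.PstarGapLemma (Sat Feasible MinInfeasible)
open Summit.PneNP.PneNP.Theorems.PstarGapPeeling (not_mem_varSet_of_private feasible_of_boundaryExpanding
  eq_empty_of_minInfeasible_empty)
open Summit.PneNP.PneNP.Theorems.PstarCentreFree (vars_mem_varSet)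
open Summit.PneNP.PneNP.Theorems.PstarChordRepair (IsChord)
open Summit.PneNP.PneNP.Theorems.PstarGapOne (PstarGapOne)
open Summit.PneNP.PneNP.Theorems.PstarGapOneAll (gval GSat GapOneAll gval_empty pstarGapOne_of_gapOneAll)
open Summit.PneNP.PneNP.Theorems.PstarGConstraint
open Summit.PneNP.PneNP.Theorems.PstarGSatSteps
open Summit.PneNP.PneNP.Theorems.PstarGSatStructure
open Summit.PneNP.PneNP.Theorems.PstarGSatNoChord
open Summit.PneNP.PneNP.Theorems.PstarGSatC4 (c4_false)
open Summit.PneNP.PneNP.Theorems.PstarGSatChords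

namespace Summit.PneNP.PneNP.Theorems.PstarGSat

/-- **T24.17′ — the reader-graph induction `GSat`.** -/
theorem gSat : GSat := by
  classical
  intro n m r I hI hT hB hS y J G C b hJr hJG hnc
  suffices H : ∀ J : Finset (Fin m), J.card ≤ r → ∀ (G : Finset (Fin m)) (C : Finset (Fin n)) (b : Bool), Disjoint J G →
      (∃ z z' : Fin n → Bool, gval I C G z ≠ gval I C G z') →
      ∃ z : Fin n → Bool, (∀ j ∈ J, I.eval z j = y j) ∧ gval I C G z = b from H J hJr G C b hJG hnc
  intro J
  induction J using Finset.strongInduction with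
  | H J ih =>
    intro hJr G C b hJG hnc
    rcases J.eq_empty_or_nonempty with rfl | hJne
    · obtain ⟨z, z', hzz⟩ := hnc
      by_cases hz : gval I C G z = b
      · exact ⟨z, fun j hj => absurd hj (notMem_empty j), hz⟩
      · refine ⟨z', fun j hj => absurd hj (notMem_empty j), ?_⟩
        revert hz hzz
        cases gval I C G z <;> cases gval I C G z' <;> cases b <;> decide
    by_contra hcon
    have hunsat : ∀ z : Fin n → Bool, (∀ j ∈ J, I.eval z j = y j) → gval I C G z ≠ b := fun z hz hb => hcon ⟨z, hz, hb⟩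
    have ih' : ∀ g ∈ J, ∀ (G' : Finset (Fin m)) (C' : Finset (Fin n)) (b' : Bool), Disjoint (J.erase g) G' →
        (∃ z z' : Fin n → Bool, gval I C' G' z ≠ gval I C' G' z') →
        ∃ z : Fin n → Bool, (∀ j ∈ J.erase g, I.eval z j = y j) ∧ gval I C' G' z = b' :=
      fun g hg G' C' b' hdis hnc' => ih (J.erase g) (erase_ssubset hg) ((card_le_card (erase_subset _ _)).trans hJr) G' C' b' hdis hnc'
    -- (a) private XOR slots lie in `C`
    have hxorC : ∀ g ∈ J, ∀ s : Fin 4, s.val < 2 → I.vars g s ∈ bdry I J → I.vars g s ∈ C := by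
      intro g hg s hs hb
      by_contra hC
      exact step_xor I hI hT y J G C b hJG hunsat ih' hnc hg hs
        (fun g' hg' hne => not_mem_varSet_of_private I hg hg' hne hb (vars_mem_varSet I g s)) hC
    -- (b) no reader
    have hnoreader : ∀ g ∈ J, ¬ (I.vars g 0 ∈ bdry I J ∧ I.vars g 1 ∈ bdry I J) := by
      rintro g hg ⟨h0, h1⟩
      exact step_reader I hI hT hS y J G C b hJG hunsat ih' hg
        (fun g' hg' hne => not_mem_varSet_of_private I hg hg' hne h0 (vars_mem_varSet I g 0))
        (fun g' hg' hne => not_mem_varSet_of_private I hg hg' hne h1 (vars_mem_varSet I g 1))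
        (hxorC g hg 0 (by decide) h0) (hxorC g hg 1 (by decide) h1)
    by_cases hch : ∃ g₀ ∈ J, IsChord I J g₀
    · -- (c) + (e)
      obtain ⟨g₀, hg₀, hc₀⟩ := hch
      have hstruct : ∀ g ∈ J, IsChord I J g →
          ((C.erase (I.vars g 2)).erase (I.vars g 3)) ∆ nbG I G (I.vars g 2) ∆ nbG I G (I.vars g 3) = ∅ ∧
            (G.filter fun g' => I.vars g 2 ∉ PstarGapLinearised.andPair I g' ∧ I.vars g 3 ∉ PstarGapLinearised.andPair I g') = ∅ :=
        fun g hg hc => chord_structure I hI hS y J G C b hJG hunsat ih' hg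
          (fun j hj hne => not_mem_varSet_of_private I hg hj hne hc.1 (vars_mem_varSet I g 2))
          (fun j hj hne => not_mem_varSet_of_private I hg hj hne hc.2 (vars_mem_varSet I g 3))
      exact chords_false I hI hT hB hS J G C hJr hnc hxorC hstruct (@c4_false n m I hI hT r hB hS y J G C b hJr hnc hunsat)
        hg₀ hc₀
    · -- (d)
      push Not at hch
      exact no_chord_false I hI hT hB hS y J G C b hJr hJG hunsat hJne hxorC hnoreader fun g hg h => hch g hg ⟨h.1, h.2⟩

/-- **T24.17 — the single-query rung for every parity: `GapOneAll`.** -/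
theorem gapOneAll : GapOneAll := by
  classical
  intro n m r I hI hT hB hS y W J hW1 hJr hmin
  by_contra hJne
  rcases W.eq_empty_or_nonempty with hW0 | hWne
  · subst hW0
    exact hJne (eq_empty_of_minInfeasible_empty I hI hB hmin hJr)
  obtain ⟨w, hWw⟩ := card_eq_one.1 (le_antisymm hW1 (card_pos.2 hWne))
  subst hWw
  obtain ⟨C, c⟩ := w
  have hsat : ∀ z : Fin n → Bool, Sat {(C, c)} z ↔ parity C z = c := fun z => by simp [Sat]
  by_cases hC : C = ∅
  · subst hC
    have hpar : ∀ z : Fin n → Bool, parity (∅ : Finset (Fin n)) z = false := fun z => by simp [PstarPDT.parity]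
    cases c
    · apply hmin.1
      obtain ⟨z, hz⟩ := feasible_of_boundaryExpanding I hI hB y J hJr
      exact ⟨z, (hsat z).2 (hpar z), hz⟩
    · obtain ⟨j, hj⟩ := nonempty_iff_ne_empty.2 hJne
      obtain ⟨z, hzW, -⟩ := hmin.2 j hj
      have := (hsat z).1 hzW
      rw [hpar] at this
      exact Bool.false_ne_true this
  · apply hmin.1
    have hnc : ∃ z z' : Fin n → Bool, gval I C ∅ z ≠ gval I C ∅ z' :=
      (gval_nonconst_iff I (G := ∅) (by simp) (by simp)).2 (Or.inl hC)
    obtain ⟨z, hz, hzb⟩ := gSat n m r I hI hT hB hS y J ∅ C c hJr (disjoint_empty_right _) hnc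
    refine ⟨z, (hsat z).2 ?_, hz⟩
    rw [gval_empty] at hzb
    exact hzb

/-- **T24.12 — the first rung of the crux, `PstarGapOne`, by name (with `K = 0`).** -/
theorem pstarGapOne : PstarGapOne := pstarGapOne_of_gapOneAll gapOneAll

end Summit.PneNP.PneNP.Theorems.PstarGSat
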